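import Summits.HodgeConjecture.HodgeCM.Literature.QuadraticCharacterLocal_1

/-! PORT of `HodgeCM/Literature/QuadraticCharacterLocal.lean` (HodgeCMPerL run 82) — part 2: continuation of `Summits.HodgeConjecture.HodgeCM.Literature.QuadraticCharacterLocal_1` (split at a top-level declaration boundary by port_pkg.py; scope re-opened below; declarations unchanged). -/

-- port_pkg: scope re-opened for this part (file-level context, then the namespace/section stack open at the cut)
set_option autoImplicit false
noncomputable section
open NumberField IsDedekindDomain
open Literature.NumberTheory.QuadraticForms
open scoped RestrictedProduct
namespace NumberField
variable (K : Type) [Field K] [NumberField K]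
section Infinite
variable {K}
variable {a : K}
/-- **`(c)_w ∈ K^× N_{K(√a)/K} J ↔ c` is a local norm at `w`** (infinite `w`, `a ≠ 0`; no sign condition
on `σ_w(a)` — at a complex place, or a real one with `σ_w(a) > 0`, both sides hold). -/
theorem infIdeleSingle_mem_quadraticNormGroup_iff (ha0 : a ≠ 0) {w : InfinitePlace K} (c : (w.Completion)ˣ) :
    infUnitsToIdele K (InfiniteAdeleRing.singleUnits K w c) ∈ quadraticNormGroup K a ↔
      c ∈ quadraticNormSubgroup w.Completion (algebraMap K _ a) := by
  classical
  constructor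
  · intro hmem
    obtain ⟨p, hp, n, hn, hpn⟩ := Subgroup.mem_sup.1 hmem
    obtain ⟨β, rfl⟩ := hp
    have hγ0 : ((β⁻¹ : Kˣ) : K) ≠ 0 := (β⁻¹).ne_zero
    have hn_eq : n = Units.map (algebraMap K (AdeleRing (𝓞 K) K) : K →* AdeleRing (𝓞 K) K) β⁻¹ *
        infUnitsToIdele K (InfiniteAdeleRing.singleUnits K w c) := by
      rw [map_inv, ← hpn, inv_mul_cancel_left]
    have hN := mem_normIdeles_iff.1 hn
    have hnu : ∀ u : HeightOneSpectrum (𝓞 K),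
        (ideleFiniteComponent K u n : u.adicCompletion K) = algebraMap K _ ((β⁻¹ : Kˣ) : K) := fun u => by
      rw [hn_eq, map_mul, ideleFiniteComponent_infUnitsToIdele, mul_one, ideleFiniteComponent_principal,
        val_unitsMap_algebraMap]
    have hnw : ∀ w' : InfinitePlace K, w' ≠ w →
        (ideleInfiniteComponent K w' n : w'.Completion) = algebraMap K _ ((β⁻¹ : Kˣ) : K) := fun w' hw' => by
      rw [hn_eq, map_mul, ideleInfiniteComponent_single_of_ne K c hw', mul_one, ideleInfiniteComponent_principal,
        val_unitsMap_algebraMap]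
    have hnv : ideleInfiniteComponent K w n =
        Units.map (algebraMap K w.Completion : K →* _) β⁻¹ * c := by
      rw [hn_eq, map_mul, ideleInfiniteComponent_principal]
      congr 1
      exact Units.ext (val_ideleInfiniteComponent_single_self K c)
    have hfin : ∀ u : HeightOneSpectrum (𝓞 K),
        hilbertSymbol (u.adicCompletion K) (algebraMap K _ ((β⁻¹ : Kˣ) : K)) (algebraMap K _ a) = 1 := by
      intro u
      haveI : CharZero (u.adicCompletion K) := charZero_of_injective_algebraMap (algebraMap K _).injective
      have h2 := (hilbertSymbol_eq_one_iff_mem_quadraticNormSubgroup (F := u.adicCompletion K)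
        ((map_ne_zero (algebraMap K (u.adicCompletion K))).2 ha0) (ideleFiniteComponent K u n)).2 (hN.1 u)
      rwa [hnu u] at h2
    have hinf : ∀ w' : InfinitePlace K, w' ≠ w →
        hilbertSymbol w'.Completion (algebraMap K _ ((β⁻¹ : Kˣ) : K)) (algebraMap K _ a) = 1 := by
      intro w' hw'
      haveI : CharZero w'.Completion := charZero_of_injective_algebraMap (algebraMap K _).injective
      have h2 := (hilbertSymbol_eq_one_iff_mem_quadraticNormSubgroup (F := w'.Completion)
        ((map_ne_zero (algebraMap K w'.Completion)).2 ha0) (ideleInfiniteComponent K w' n)).2 (hN.2 w')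
      rwa [hnw w' hw'] at h2
    haveI : CharZero w.Completion := charZero_of_injective_algebraMap (algebraMap K _).injective
    have ha0w : algebraMap K w.Completion a ≠ 0 := (map_ne_zero _).2 ha0
    have hγN : Units.map (algebraMap K w.Completion : K →* _) β⁻¹ ∈
        quadraticNormSubgroup w.Completion (algebraMap K _ a) := by
      refine (hilbertSymbol_eq_one_iff_mem_quadraticNormSubgroup ha0w _).1 ?_
      rw [val_unitsMap_algebraMap]
      exact hilbertSymbol_eq_one_of_forall_ne_infinite hγ0 ha0 w hfin hinf
    have hγcN := hN.2 w
    rw [hnv] at hγcN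
    have h := Subgroup.mul_mem _ (Subgroup.inv_mem _ hγN) hγcN
    rwa [inv_mul_cancel_left] at h
  · intro hc
    refine normIdeles_le_quadraticNormGroup K a (mem_normIdeles_iff.2 ⟨fun u => ?_, fun w' => ?_⟩)
    · rw [ideleFiniteComponent_infUnitsToIdele]
      exact Subgroup.one_mem _
    · by_cases hw' : w' = w
      · subst hw'
        have h1 : ideleInfiniteComponent K w' (infUnitsToIdele K (InfiniteAdeleRing.singleUnits K w' c)) = c :=
          Units.ext (val_ideleInfiniteComponent_single_self K c)
        rwa [h1]
      · rw [ideleInfiniteComponent_single_of_ne K c hw']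
        exact Subgroup.one_mem _

variable (ha : ¬ IsSquare a)

/-- **`ε((c)_w) = 1 ↔ (c, a)_w = 1`** at an infinite place `w`. -/
theorem quadraticCharacter_infIdeleSingle_eq_one_iff {w : InfinitePlace K} (c : (w.Completion)ˣ) :
    quadraticCharacter ha (infUnitsToClass K (InfiniteAdeleRing.singleUnits K w c)) = 1 ↔
      hilbertSymbol w.Completion (c : w.Completion) (algebraMap K _ a) = 1 := by
  have ha0 : a ≠ 0 := fun h => ha (h ▸ IsSquare.zero)
  haveI : CharZero w.Completion := charZero_of_injective_algebraMap (algebraMap K _).injective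
  have hmk : infUnitsToClass K (InfiniteAdeleRing.singleUnits K w c) =
      (QuotientGroup.mk (infUnitsToIdele K (InfiniteAdeleRing.singleUnits K w c)) : IdeleClassGroup K) := rfl
  rw [hmk, quadraticCharacter_mk_eq_one_iff, infIdeleSingle_mem_quadraticNormGroup_iff ha0,
    hilbertSymbol_eq_one_iff_mem_quadraticNormSubgroup ((map_ne_zero _).2 ha0)]

/-- **`ε((c)_w) = (c, a)_w`** at an infinite place `w`. -/
theorem coe_quadraticCharacter_infIdeleSingle {w : InfinitePlace K} (c : (w.Completion)ˣ) :
    ((quadraticCharacter ha (infUnitsToClass K (InfiniteAdeleRing.singleUnits K w c)) : Circle) : ℂ) =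
      (hilbertSymbol w.Completion (c : w.Completion) (algebraMap K _ a) : ℂ) := by
  rcases hilbertSymbol_eq_one_or_eq_neg_one (c : w.Completion) (algebraMap K _ a) with h | h
  · rw [h, (quadraticCharacter_infIdeleSingle_eq_one_iff ha c).2 h, Circle.coe_one, Int.cast_one]
  · have hne : quadraticCharacter ha (infUnitsToClass K (InfiniteAdeleRing.singleUnits K w c)) ≠ 1 := fun h1 => by
      have h2 := (quadraticCharacter_infIdeleSingle_eq_one_iff ha c).1 h1
      rw [h] at h2
      norm_num at h2
    have hmk : infUnitsToClass K (InfiniteAdeleRing.singleUnits K w c) =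
        (QuotientGroup.mk (infUnitsToIdele K (InfiniteAdeleRing.singleUnits K w c)) : IdeleClassGroup K) := rfl
    have hval : quadraticCharacter ha (infUnitsToClass K (InfiniteAdeleRing.singleUnits K w c)) = -1 := by
      rw [hmk, quadraticCharacter_mk]
      refine quadraticCharacterIdele_apply_of_not_mem ha fun hmem => hne ?_
      rw [hmk, quadraticCharacter_mk_eq_one_iff]
      exact hmem
    rw [h, hval, Circle.coe_neg, Circle.coe_one, Int.cast_neg, Int.cast_one]

end Infinite

/-! ## Non-dyadic places where `a` is a unit: units are killed, `ε((π)_v)` is the Legendre symbol of `a` -/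

section NonDyadic

variable {K}
variable {a : K} (ha : ¬ IsSquare a)

/-- **`ε((u)_v) = 1` for a local unit `u`** at a non-dyadic place `v` where `a` is a unit
(O'Meara 63:16 / Example 65:4: units are norms from the unramified `K_v(√a)`). -/
theorem quadraticCharacter_finIdeleSingle_of_valued_eq_one {v : HeightOneSpectrum (𝓞 K)}
    (h2 : (2 : 𝓞 K) ∉ v.asIdeal) (hav : v.valuation K a = 1)
    {u : (v.adicCompletion K)ˣ} (hu : Valued.v (u : v.adicCompletion K) = 1) :
    quadraticCharacter ha (finIdeleSingleClass K v u) = 1 := by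
  have ha0 : a ≠ 0 := fun h => ha (h ▸ IsSquare.zero)
  rw [finIdeleSingleClass_apply, quadraticCharacter_mk_eq_one_iff, finIdeleSingle_mem_quadraticNormGroup_iff ha0]
  exact OMeara65.mem_quadraticNormSubgroup_of_valued_eq_one v h2 hav hu

/-- **The Frobenius dictionary.** At a non-dyadic place `v` with `a = b ∈ 𝓞 K` a `v`-unit and `π ∈ 𝓞 K`
a uniformiser at `v`: `ε((π)_v) = 1 ↔ b` is a square modulo `v` (O'Meara Example 63:12,
"`(π, δ)_𝔭 = 1` if and only if `δ` is a square"; vendored `hilbertSymbol_uniformizer_mul_iff`).  So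
`ε((π)_v) = +1` at the places of `K` split in `K(√b)` and `= -1` at the inert ones. -/
theorem quadraticCharacter_finIdeleSingle_uniformizer_eq_one_iff {b : 𝓞 K} (hb : ¬ IsSquare (b : K))
    {v : HeightOneSpectrum (𝓞 K)} (h2 : (2 : 𝓞 K) ∉ v.asIdeal) (hbv : b ∉ v.asIdeal) {π : 𝓞 K}
    (hπ : v.intValuation π = WithZero.exp (-1 : ℤ)) {c : (v.adicCompletion K)ˣ}
    (hc : (c : v.adicCompletion K) = algebraMap (𝓞 K) (v.adicCompletion K) π) :
    quadraticCharacter hb (finIdeleSingleClass K v c) = 1 ↔ IsSquare (Ideal.Quotient.mk v.asIdeal b) := by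
  haveI : v.asIdeal.IsPrime := v.isPrime
  have h1v : (1 : 𝓞 K) ∉ v.asIdeal := fun h => Ideal.IsPrime.ne_top ‹_› ((Ideal.eq_top_iff_one _).2 h)
  have h1 : hilbertSymbol (v.adicCompletion K) (algebraMap (𝓞 K) _ (π * 1)) (algebraMap (𝓞 K) _ b) = 1 ↔
      IsSquare (Ideal.Quotient.mk v.asIdeal b) :=
    hilbertSymbol_uniformizer_mul_iff K v h2 hπ h1v hbv
  rw [mul_one] at h1
  have hbK : algebraMap K (v.adicCompletion K) (b : K) = algebraMap (𝓞 K) (v.adicCompletion K) b :=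
    (IsScalarTower.algebraMap_apply (𝓞 K) K (v.adicCompletion K) b).symm
  rw [quadraticCharacter_finIdeleSingle_eq_one_iff, hc, hbK, h1]

end NonDyadic

/-! ## O'Meara's product formula: `ε(𝔦) = ∏_v (𝔦_v, a)_v` for every idèle `𝔦` -/

section ProductFormula

variable {K}
variable {a : K}

/-- The idèle-level form of `ε((c)_v) = (c, a)_v` at a finite place. -/
theorem coe_quadraticCharacterIdele_finIdeleSingle (ha : ¬ IsSquare a) {v : HeightOneSpectrum (𝓞 K)}
    (c : (v.adicCompletion K)ˣ) :
    ((quadraticCharacterIdele a ha (finIdeleSingle K v c) : Circle) : ℂ) =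
      (hilbertSymbol (v.adicCompletion K) (c : v.adicCompletion K) (algebraMap K _ a) : ℂ) := by
  rw [← coe_quadraticCharacter_finIdeleSingle ha c, finIdeleSingleClass_apply, quadraticCharacter_mk]

/-- The idèle-level form of `ε((c)_w) = (c, a)_w` at an infinite place. -/
theorem coe_quadraticCharacterIdele_infIdeleSingle (ha : ¬ IsSquare a) {w : InfinitePlace K} (c : (w.Completion)ˣ) :
    ((quadraticCharacterIdele a ha (infUnitsToIdele K (InfiniteAdeleRing.singleUnits K w c)) : Circle) : ℂ) =
      (hilbertSymbol w.Completion (c : w.Completion) (algebraMap K _ a) : ℂ) := by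
  rw [← coe_quadraticCharacter_infIdeleSingle ha c]
  rfl

/-- **Almost all components of an idèle are local norms**: for `a ≠ 0` and an idèle `𝔦`, the finite
places `v` with `𝔦_v ∉ N(K_v(√a)^×)` form a finite set (they are among the dyadic places, the places
where `a` is not a unit, and the places where `𝔦_v` is not a unit — O'Meara 63:16). -/
theorem finite_setOf_ideleFiniteComponent_not_mem (ha0 : a ≠ 0) (x : ideleGroup K) :
    {v : HeightOneSpectrum (𝓞 K) | ideleFiniteComponent K v x ∉
        quadraticNormSubgroup (v.adicCompletion K) (algebraMap K _ a)}.Finite := by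
  have h := FiniteAdeleRing.unitsEquiv_finite_valued_eq_one
    (Units.map (RingHom.snd (InfiniteAdeleRing K) (FiniteAdeleRing (𝓞 K) K) :
      AdeleRing (𝓞 K) K →+* FiniteAdeleRing (𝓞 K) K).toMonoidHom x)
  refine (((Filter.eventually_cofinite.mp h).union (OMeara65.finite_setOf_two_mem K)).union
    (Literature.NumberTheory.Automorphic.finite_setOf_valuation_ne_one K ha0)).subset fun v hv => ?_
  by_contra hnot
  simp only [Set.mem_union, Set.mem_setOf_eq, not_or, not_not] at hnot
  obtain ⟨⟨hx1, h2⟩, hav⟩ := hnot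
  change Valued.v ((x : AdeleRing (𝓞 K) K).2 v) = 1 at hx1
  exact hv (OMeara65.mem_quadraticNormSubgroup_of_valued_eq_one v h2 hav (t := ideleFiniteComponent K v x) hx1)

/-- If `𝔦_v` is a local norm then `(𝔦_v, a)_v = 1`. -/
theorem hilbertSymbol_ideleComponent_eq_one_of_mem (ha0 : a ≠ 0) {x : ideleGroup K} {v : HeightOneSpectrum (𝓞 K)}
    (hmem : ideleFiniteComponent K v x ∈ quadraticNormSubgroup (v.adicCompletion K) (algebraMap K _ a)) :
    hilbertSymbol (v.adicCompletion K) ((x : AdeleRing (𝓞 K) K).2 v) (algebraMap K _ a) = 1 := by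
  haveI : CharZero (v.adicCompletion K) := charZero_of_injective_algebraMap (algebraMap K _).injective
  have h1 := (hilbertSymbol_eq_one_iff_mem_quadraticNormSubgroup (F := v.adicCompletion K)
    ((map_ne_zero (algebraMap K (v.adicCompletion K))).2 ha0) (ideleFiniteComponent K v x)).2 hmem
  rwa [val_ideleFiniteComponent] at h1

/-- Hence `(𝔦_v, a)_v = 1` for all but finitely many `v`: the function `v ↦ (𝔦_v, a)_v ∈ ℂ` has finite
multiplicative support. -/
theorem finite_mulSupport_hilbertSymbol_idele (ha0 : a ≠ 0) (x : ideleGroup K) :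
    (Function.mulSupport fun v : HeightOneSpectrum (𝓞 K) =>
      (hilbertSymbol (v.adicCompletion K) ((x : AdeleRing (𝓞 K) K).2 v) (algebraMap K _ a) : ℂ)).Finite := by
  refine (finite_setOf_ideleFiniteComponent_not_mem ha0 x).subset fun v hv => ?_
  rw [Function.mem_mulSupport] at hv
  rw [Set.mem_setOf_eq]
  intro hmem
  exact hv (by rw [hilbertSymbol_ideleComponent_eq_one_of_mem ha0 hmem, Int.cast_one])

/-- The archimedean part `x_∞ ∈ K_∞^×` of an idèle (namespaced to avoid the clash with pv11-g5's
`NumberField.ideleInfPart` of `HodgeCM/PerL34/UnitaryLineChars.lean`, the same map with the field explicit). -/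
def QuadraticCharacterLocal.ideleInfPart : ideleGroup K →* (InfiniteAdeleRing K)ˣ :=
  Units.map (RingHom.fst (InfiniteAdeleRing K) (FiniteAdeleRing (𝓞 K) K)).toMonoidHom

/-- (Ported verbatim from the HodgeCMPerL package; no docstring in the source.) -/
@[simp] theorem QuadraticCharacterLocal.val_ideleInfPart_apply (x : ideleGroup K) (w : InfinitePlace K) :
    (QuadraticCharacterLocal.ideleInfPart x : InfiniteAdeleRing K) w = (x : AdeleRing (𝓞 K) K).1 w := rfl

/-- **O'Meara's formula `φ(𝔦) = ∏_𝔭 (𝔦_𝔭, a / 𝔭)`** (proof of 71:19) for the constructed character: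
for every idèle `𝔦`, `ε(𝔦) = ∏_{v finite} (𝔦_v, a)_v · ∏_{w infinite} (𝔦_w, a)_w`, the first product
having only finitely many factors `≠ 1` (`finite_mulSupport_hilbertSymbol_idele`).  Proof: `𝔦 = s·t·r`
with `s = ∏_{v ∈ T} (𝔦_v)_v` over the finite set `T` of finite places where `𝔦_v` is not a local norm,
`t = ∏_w (𝔦_w)_w`, and `r` a norm idèle (killed by `ε`); then use `ε((c)_v) = (c, a)_v`. -/
theorem coe_quadraticCharacterIdele_eq_finprod_mul_prod (ha : ¬ IsSquare a) (x : ideleGroup K) :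
    ((quadraticCharacterIdele a ha x : Circle) : ℂ) =
      (∏ᶠ v : HeightOneSpectrum (𝓞 K),
          (hilbertSymbol (v.adicCompletion K) ((x : AdeleRing (𝓞 K) K).2 v) (algebraMap K _ a) : ℂ)) *
        ∏ w : InfinitePlace K,
          (hilbertSymbol w.Completion ((x : AdeleRing (𝓞 K) K).1 w) (algebraMap K _ a) : ℂ) := by
  classical
  have ha0 : a ≠ 0 := fun h => ha (h ▸ IsSquare.zero)
  set T := (finite_setOf_ideleFiniteComponent_not_mem ha0 x).toFinset with hT
  have hTmem : ∀ v, v ∈ T ↔ ideleFiniteComponent K v x ∉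
      quadraticNormSubgroup (v.adicCompletion K) (algebraMap K _ a) := fun v => by
    rw [hT, Set.Finite.mem_toFinset, Set.mem_setOf_eq]
  -- the finite-place part `s` and the archimedean part `t`
  set s : ideleGroup K := ∏ v ∈ T, finIdeleSingle K v (ideleFiniteComponent K v x) with hs
  set t : ideleGroup K := infUnitsToIdele K (QuadraticCharacterLocal.ideleInfPart x) with ht
  -- components of `s` and `t`
  have hs_fin_mem : ∀ u ∈ T, ideleFiniteComponent K u s = ideleFiniteComponent K u x := fun u hu => by
    rw [hs, map_prod, Finset.prod_eq_single u (fun v _ hvu => ideleFiniteComponent_finIdeleSingle_of_ne K v _ (Ne.symm hvu))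
      (fun h => absurd hu h), ideleFiniteComponent_finIdeleSingle_self]
  have hs_fin_nmem : ∀ u ∉ T, ideleFiniteComponent K u s = 1 := fun u hu => by
    rw [hs, map_prod]
    refine Finset.prod_eq_one fun v hv => ideleFiniteComponent_finIdeleSingle_of_ne K v _ ?_
    rintro rfl
    exact hu hv
  have hs_inf : ∀ w : InfinitePlace K, ideleInfiniteComponent K w s = 1 := fun w => by
    rw [hs, map_prod]
    exact Finset.prod_eq_one fun v _ => ideleInfiniteComponent_finIdeleSingle K v _ w
  have ht_fin : ∀ u : HeightOneSpectrum (𝓞 K), ideleFiniteComponent K u t = 1 := fun u =>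
    ideleFiniteComponent_infUnitsToIdele K _ u
  have ht_inf : ∀ w : InfinitePlace K, ideleInfiniteComponent K w t = ideleInfiniteComponent K w x := fun w =>
    Units.ext (by rw [ht, val_ideleInfiniteComponent_infUnitsToIdele, QuadraticCharacterLocal.val_ideleInfPart_apply,
      val_ideleInfiniteComponent])
  -- the remainder `r = x (s t)⁻¹` is a norm idèle
  have hr : x * (s * t)⁻¹ ∈ normIdeles K a := by
    refine mem_normIdeles_iff.2 ⟨fun u => ?_, fun w => ?_⟩
    · rw [map_mul, map_inv, map_mul, ht_fin, mul_one]
      by_cases hu : u ∈ T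
      · rw [hs_fin_mem u hu, mul_inv_cancel]
        exact Subgroup.one_mem _
      · rw [hs_fin_nmem u hu, inv_one, mul_one]
        exact not_not.1 ((hTmem u).not.1 hu)
    · rw [map_mul, map_inv, map_mul, hs_inf, one_mul, ht_inf, mul_inv_cancel]
      exact Subgroup.one_mem _
  have hx : x = s * t * (x * (s * t)⁻¹) := (mul_inv_cancel_comm_assoc (s * t) x).symm
  conv_lhs => rw [hx]
  rw [map_mul, map_mul, (quadraticCharacterIdele_eq_one_iff ha _).2 (normIdeles_le_quadraticNormGroup K a hr),
    mul_one, Circle.coe_mul]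
  congr 1
  · -- the finite places: `ε(s) = ∏_{v ∈ T} (x_v, a)_v = ∏ᶠ_v (x_v, a)_v`
    rw [hs, map_prod, ← Circle.coeHom_apply, map_prod, finprod_eq_prod_of_mulSupport_subset _ (s := T) ?_]
    · refine Finset.prod_congr rfl fun v _ => ?_
      rw [Circle.coeHom_apply, coe_quadraticCharacterIdele_finIdeleSingle, val_ideleFiniteComponent]
    · intro v hv
      rw [Finset.mem_coe, hTmem]
      intro hmem
      exact hv (by dsimp only; rw [hilbertSymbol_ideleComponent_eq_one_of_mem ha0 hmem, Int.cast_one])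
  · -- the infinite places: `ε(t) = ∏_w (x_w, a)_w`
    rw [ht]
    conv_lhs => rw [← prod_singleUnits_infCoord K (QuadraticCharacterLocal.ideleInfPart x)]
    rw [map_prod, map_prod, ← Circle.coeHom_apply, map_prod]
    refine Finset.prod_congr rfl fun w _ => ?_
    rw [Circle.coeHom_apply, coe_quadraticCharacterIdele_infIdeleSingle, val_infCoord,
      QuadraticCharacterLocal.val_ideleInfPart_apply]

/-- The same for the class character: `ε([𝔦]) = ∏_v (𝔦_v, a)_v`. -/
theorem coe_quadraticCharacter_mk_eq_finprod_mul_prod (ha : ¬ IsSquare a) (x : ideleGroup K) :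
    ((quadraticCharacter ha (QuotientGroup.mk x : IdeleClassGroup K) : Circle) : ℂ) =
      (∏ᶠ v : HeightOneSpectrum (𝓞 K),
          (hilbertSymbol (v.adicCompletion K) ((x : AdeleRing (𝓞 K) K).2 v) (algebraMap K _ a) : ℂ)) *
        ∏ w : InfinitePlace K,
          (hilbertSymbol w.Completion ((x : AdeleRing (𝓞 K) K).1 w) (algebraMap K _ a) : ℂ) := by
  rw [quadraticCharacter_mk, coe_quadraticCharacterIdele_eq_finprod_mul_prod]

end ProductFormula

end NumberField

-- port_pkg: scope closed for this part
end
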